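import Summits.Ventures.HSemireg.WedgeHankelSecantKernel
import Summits.Ventures.HSemireg.WedgeHankelSecantPointRank

/-!
# Venture HSemireg — THE PROJECTIVE SECANT KERNEL LAW: `Kr(univ, w_m(Σ_{i<r} A_i λ_i^• + c·δ_m), k) = ⋂_{i<r} F_{λ_i}(k) ∩ F_∞(k)`
# for `r + 1 ≤ min(k+1, m+1−k)` — the point's frame ideal `F_∞(k) = Σ_a y_a ∧ Hom(univ, k−1)` joins the finite frames

HONEST FRAMING. Part of the Lean index of the computation cell `pub-hsemireg` (seat p10 gen 14, Sunday typer «UNIFORM-IN-n»).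
Finite-dimensional EXTERIOR ALGEBRA over a field and ranks of HANKEL MATRICES ONLY: no variety, no cohomology theory, no sheaf, no Ext
group and no semiregularity map is constructed here; nothing here says that HC / HC_CM / HC_AV holds; no Literature fact is declared or
used.  Custodian versions cited: theory/FORMULA-N.md PART A §2.6 THEOREM H and its KRONECKER DICTIONARY (ρ = 2: `1 − pt` = th-7's point
pair, the real pair, the `K`-secant); STRUCTURE.md v1.0-SIGNED 9b196a05977dd067 §1.1 C15.  The dictionary (`Σ_i A_i exp(λ_i Θ) + c·pt` ↦
`q_j = Σ_i A_i λ_i^j + c·[j = m]` ↦ `w_m(q)`; `⌟v` on `HT^k` ↦ `θ ↦ θ ∧ w_m(q)` on `⋀^k K^{2m}`) is QUOTED, never asserted.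

WHAT IS KEYED.  D2 (`WedgeHankelSecantKernel`): THE SECANT KERNEL LAW for finite slopes, `Kr = ⋂_{i<r} F_{λ_i}(k)` (`r ≤ min(k+1, m+1−k)`),
and the codimension tool; D4 (`WedgeHankelSecantPointRank`): `rank H_k(Σ_i A_i λ_i^• + c·δ_m) = r + 1`; C7 (`WedgeHankelPointKernel`): the
point's kernel is the `y`-frame ideal `F_∞(k) = Σ_a y_a ∧ Hom(univ, k−1)` (`Kr_w_point`); C11: the point pair `a·1 + c·pt` has kernel
`F_0(k) ∩ F_∞(k)` (`0 < k < m`).  THIS FILE names the kernel of every secant THROUGH THE POINT: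
* §1 **`w_psecSeq`: `w_m(Σ_i A_i λ_i^• + c·δ_m) = Σ_i A_i · u^{λ_i}_0 ∧ ⋯ ∧ u^{λ_i}_{m−1} + c · E_{y-block}`**; the containment
  **`iInf_frameIdeal_inf_le_Kr_psecSeq`: `(⋂_i F_{λ_i}(k)) ∩ F_∞(k) ≤ Kr`** (`k ≥ 1`, `m ≥ 1`).
* §2 the count for ANY finite slopes: `C(2m,k) ≤ dim((⋂_i F_{λ_i}(k)) ∩ F_∞(k)) + (r+1)·C(m,k)` (D2's count for the `r` finite frames, then
  one more codimension-`C(m,k)` step for `F_∞(k)`, `finrank_frameIdeal_Y`).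
* §3 **THE PROJECTIVE SECANT KERNEL LAW `Kr_w_psecSeq`: for distinct finite slopes, non-zero weights, `c ≠ 0`, `1 ≤ k`, `r + 1 ≤ k + 1`,
  `r + 1 ≤ m + 1 − k`: `Kr(univ, w_m(Σ_{i<r} A_i λ_i^• + c·δ_m), k) = (⋂_{i<r} F_{λ_i}(k)) ∩ F_∞(k)`** — the forms killing the class are
  exactly those killing each exponential AND the point; independent of the weights; wedge form.  `r = 0`: C7's point (`k ≤ m`); `r = 1`,
  `λ = 0`: C11's point pair; `r = 1`, any `λ`: **the point plus one exponential, `F_λ(k) ∩ F_∞(k)`** (`Kr_w_exp_add_point`, new).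
* §4 **`finrank_iInf_frameIdeal_inf_add`: `dim((⋂_{i<r} F_{λ_i}(k)) ∩ F_∞(k)) + (r+1)·C(m,k) = C(2m,k)`** — `r` finite frames and the
  frame at infinity are in general position (`r + 1 ≤ min(k+1, m+1−k)`).
Namespace `Summit.Ventures.HSemireg.Wedge.HankelSecant` (continued); new names only.
-/

open Module

namespace Summit.Ventures.HSemireg.Wedge.HankelSecant

open Summit.Ventures.HSemireg.Wedge Summit.Ventures.HSemireg.Wedge.Kunneth Summit.Ventures.HSemireg.Wedge.KunnethKernel
  Summit.Ventures.HSemireg.Wedge.HankelFaces Summit.Ventures.HSemireg.Wedge.HankelBox Summit.Ventures.HSemireg.Wedge.HankelPureKernel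

variable (K : Type*) [Field K] (m : ℕ)

/-! ## §1. The class of a secant through the point; containment -/

/-- **`w_m(Σ_i A_i λ_i^• + c·δ_m) = Σ_i A_i · u^{λ_i}_0 ∧ ⋯ ∧ u^{λ_i}_{m−1} + c · E_{y-block}`** (`m ≥ 1`; top degree). -/
theorem w_psecSeq (hm : 1 ≤ m) {r : ℕ} (A lam : Fin r → K) (c : K) :
    Hankel.w K m m (psecSeq K m A lam c) = (∑ i, A i • uprod K m (lam i) m) + c • B K (Hankel.In m) (WedgePair.Yset m) := by
  rw [psecSeq, w_add', w_secSeq, w_ppSeq_zero K m hm]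

/-- **`(⋂_{i<r} F_{λ_i}(k)) ∩ F_∞(k) ≤ Kr(univ, w_m(Σ_i A_i λ_i^• + c·δ_m), k)`** (`k ≥ 1`, `m ≥ 1`): a form killing every exponential and the
point kills the class (C6's and C7's kernel names). -/
theorem iInf_frameIdeal_inf_le_Kr_psecSeq (hm : 1 ≤ m) {r : ℕ} (A lam : Fin r → K) (c : K) {k : ℕ} (hk : 1 ≤ k) :
    (⨅ i, frameIdeal K m (uvec K m (lam i)) k) ⊓ frameIdeal K m (Hankel.Y K m) k ≤
      Kr K Finset.univ (Hankel.w K m m (psecSeq K m A lam c)) k := by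
  intro θ hθ
  obtain ⟨h1, h2⟩ := Submodule.mem_inf.mp hθ
  rw [Submodule.mem_iInf] at h1
  have h : ∀ i, θ * uprod K m (lam i) m = 0 := by
    intro i
    have hi := h1 i
    rw [← Kr_w_expSeq K m one_ne_zero (lam i) hk, mem_Kr, w_expSeq, one_smul] at hi
    exact hi.2
  rw [← Kr_w_point K m hm one_ne_zero hk, mem_Kr, w_ppSeq_zero K m hm, one_smul] at h2
  refine mem_Kr.mpr ⟨h2.1, ?_⟩
  rw [w_psecSeq K m hm, mul_add, Finset.mul_sum, mul_smul_comm, h2.2, smul_zero, add_zero]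
  refine Finset.sum_eq_zero fun i _ => ?_
  rw [mul_smul_comm, h i, smul_zero]

/-! ## §2. The count for any slopes -/

/-- `dim Hom(univ, k) = C(2m, k)` (private copy). -/
private lemma finrank_Hom_univ' (k : ℕ) : finrank K (Hom K (Hankel.In m) Finset.univ k) = (m + m).choose k := by
  rw [Hom_univ_eq_exteriorPower, exteriorPower.finrank_eq, finrank_fintype_fun_eq_card, Fintype.card_fin]

/-- the point's frame ideal has codimension `C(m,k)` too: `dim F_∞(k) = C(2m,k) − C(m,k)` (`m ≥ 1`, `k ≥ 1`; C7). -/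
theorem finrank_frameIdeal_Y (hm : 1 ≤ m) {k : ℕ} (hk : 1 ≤ k) :
    finrank K (frameIdeal K m (Hankel.Y K m) k) = (m + m).choose k - m.choose k := by
  rw [← Kr_w_point K m hm one_ne_zero hk]
  exact finrank_Kr_w_point K m hm one_ne_zero k

/-- for ANY finite slopes (`m ≥ 1`, `k ≥ 1`): **`C(2m,k) ≤ dim((⋂_{i<r} F_{λ_i}(k)) ∩ F_∞(k)) + (r+1)·C(m,k)`** — D2's count for the finite
frames, then one more codimension-`C(m,k)` step for the frame at infinity. -/
theorem iInf_frameIdeal_inf_ge (hm : 1 ≤ m) {r : ℕ} (lam : Fin r → K) {k : ℕ} (hk : 1 ≤ k) :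
    (m + m).choose k ≤ finrank K ↥((⨅ i, frameIdeal K m (uvec K m (lam i)) k) ⊓ frameIdeal K m (Hankel.Y K m) k) + (r + 1) * m.choose k := by
  have hY : frameIdeal K m (Hankel.Y K m) k ≤ Hom K (Hankel.In m) Finset.univ k := by
    rw [← Kr_w_point K m hm one_ne_zero hk]; exact Kr_le_Hom K _ _ _
  have hdY := finrank_frameIdeal_Y K m hm hk
  have hle : m.choose k ≤ (m + m).choose k := Nat.choose_le_choose k (by omega)
  rcases Nat.eq_zero_or_pos r with rfl | hr
  · have e : (⨅ i : Fin 0, frameIdeal K m (uvec K m (lam i)) k) = ⊤ := iInf_of_empty _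
    rw [e, top_inf_eq, hdY]
    omega
  · have hX := iInf_frameIdeal_ge K m hr lam hk
    have hXH := iInf_frameIdeal_le_Hom K m hr lam hk
    have key := Submodule.finrank_sup_add_finrank_inf_eq (⨅ i, frameIdeal K m (uvec K m (lam i)) k) (frameIdeal K m (Hankel.Y K m) k)
    have hsup : finrank K ↥((⨅ i, frameIdeal K m (uvec K m (lam i)) k) ⊔ frameIdeal K m (Hankel.Y K m) k) ≤ (m + m).choose k := by
      rw [← finrank_Hom_univ' K m k]
      exact Submodule.finrank_mono (sup_le hXH hY)
    rw [hdY] at key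
    have : (r + 1) * m.choose k = r * m.choose k + m.choose k := by ring
    omega

/-! ## §3. The projective secant kernel law -/

/-- `V(univ, f, a)` is the range of th-7's `θ ↦ θ ∧ f ∣ ⋀^a` (private copy; cf. C3's `V_univ_w`). -/
private lemma V_univ_eq_range' (a : ℕ) (f : HT K (Hankel.In m)) :
    V K (Hankel.In m) Finset.univ f a = LinearMap.range (Hankel.wedge K m a f) := by
  rw [V_eq_map, Hom_univ_eq_exteriorPower, Hankel.wedge, LinearMap.range_comp, Submodule.range_subtype]

/-- rank–nullity against THEOREM H (private copy of C3's `finrank_Kr_w_add`). -/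
private lemma finrank_Kr_w_add'' (a : ℕ) (q : ℕ → K) :
    finrank K (Kr K Finset.univ (Hankel.w K m m q) a) + m.choose a * (Hankel.hankel1 K m a q).rank = (m + m).choose a := by
  have h := finrank_Kr_add_finrank_V K (Finset.univ : Finset (Hankel.In m)) (Hankel.w K m m q) a
  rw [Finset.card_univ, Fintype.card_fin, V_univ_eq_range', Hankel.hankelLaw_model] at h
  exact h

/-- the kernel NUMBER of a secant through the point (`r + 1 ≤ k + 1`, `r + 1 ≤ m + 1 − k`, distinct finite slopes, non-zero weights, `c ≠ 0`):
**`dim Kr + (r+1)·C(m,k) = C(2m,k)`**. -/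
theorem finrank_Kr_w_psecSeq_add {r k : ℕ} (hrk : r + 1 ≤ k + 1) (hrm : r + 1 ≤ m + 1 - k) {A lam : Fin r → K} (hA : ∀ i, A i ≠ 0)
    {c : K} (hc : c ≠ 0) (hlam : Function.Injective lam) :
    finrank K (Kr K Finset.univ (Hankel.w K m m (psecSeq K m A lam c)) k) + (r + 1) * m.choose k = (m + m).choose k := by
  have h := finrank_Kr_w_add'' K m k (psecSeq K m A lam c)
  rw [rank_hankel1_psecSeq hrk hrm hA hc hlam, Nat.mul_comm] at h
  exact h

/-- **THE PROJECTIVE SECANT KERNEL LAW.**  For distinct finite slopes `λ_0, …, λ_{r−1}`, non-zero weights `A_i`, `c ≠ 0`, and a degree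
`k ≥ 1` with `r + 1 ≤ k + 1` and `r + 1 ≤ m + 1 − k`:
**`Kr(univ, w_m(Σ_{i<r} A_i λ_i^• + c·δ_m), k) = (⋂_{i<r} F_{λ_i}(k)) ∩ F_∞(k)`**, `F_∞(k) = Σ_a y_a ∧ Hom(univ, k−1)` — the forms killing
the class are exactly those killing each of its exponentials and the point (every field, every `m`).  `r = 0`: C7's point; `r = 1`,
`λ = 0`: C11's point pair `a·1 + c·pt`. -/
theorem Kr_w_psecSeq {r k : ℕ} (hk : 1 ≤ k) (hrk : r + 1 ≤ k + 1) (hrm : r + 1 ≤ m + 1 - k) {A lam : Fin r → K} (hA : ∀ i, A i ≠ 0)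
    {c : K} (hc : c ≠ 0) (hlam : Function.Injective lam) :
    Kr K Finset.univ (Hankel.w K m m (psecSeq K m A lam c)) k =
      (⨅ i, frameIdeal K m (uvec K m (lam i)) k) ⊓ frameIdeal K m (Hankel.Y K m) k := by
  have hm : 1 ≤ m := by omega
  refine (Submodule.eq_of_le_of_finrank_le (iInf_frameIdeal_inf_le_Kr_psecSeq K m hm A lam c hk) ?_).symm
  have h1 := finrank_Kr_w_psecSeq_add K m hrk hrm hA hc hlam
  have h2 := iInf_frameIdeal_inf_ge K m hm lam hk
  omega

/-- in particular the kernel does not depend on the (non-zero) weights `A_i`, `c`. -/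
theorem Kr_w_psecSeq_indep {r k : ℕ} (hk : 1 ≤ k) (hrk : r + 1 ≤ k + 1) (hrm : r + 1 ≤ m + 1 - k) {A A' lam : Fin r → K}
    (hA : ∀ i, A i ≠ 0) (hA' : ∀ i, A' i ≠ 0) {c c' : K} (hc : c ≠ 0) (hc' : c' ≠ 0) (hlam : Function.Injective lam) :
    Kr K Finset.univ (Hankel.w K m m (psecSeq K m A lam c)) k = Kr K Finset.univ (Hankel.w K m m (psecSeq K m A' lam c')) k := by
  rw [Kr_w_psecSeq K m hk hrk hrm hA hc hlam, Kr_w_psecSeq K m hk hrk hrm hA' hc' hlam]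

/-- wedge form: **`ker(θ ↦ θ ∧ w_m(Σ_i A_i λ_i^• + c·δ_m) ∣ ⋀^k) = (⋂_i F_{λ_i}(k)) ∩ F_∞(k)`** (comapped), same hypotheses. -/
theorem ker_wedge_w_psecSeq {r k : ℕ} (hk : 1 ≤ k) (hrk : r + 1 ≤ k + 1) (hrm : r + 1 ≤ m + 1 - k) {A lam : Fin r → K}
    (hA : ∀ i, A i ≠ 0) {c : K} (hc : c ≠ 0) (hlam : Function.Injective lam) :
    LinearMap.ker (wedge K (Hankel.In m) k (Hankel.w K m m (psecSeq K m A lam c))) =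
      ((⨅ i, frameIdeal K m (uvec K m (lam i)) k) ⊓ frameIdeal K m (Hankel.Y K m) k).comap (⋀[K]^k (Hankel.In m → K)).subtype := by
  rw [ker_wedge_eq_comap_Kr, Kr_w_psecSeq K m hk hrk hrm hA hc hlam]

/-- the case `r = 1`: **THE POINT PLUS ONE EXPONENTIAL — `Kr(univ, w_m(A λ^• + c·δ_m), k) = F_λ(k) ∩ F_∞(k)`** for `A, c ≠ 0`, `1 ≤ k ≤ m − 1`,
every slope `λ` (C11 is `λ = 0`: the point pair `A·1 + c·pt`). -/
theorem Kr_w_exp_add_point {k : ℕ} (hk : 1 ≤ k) (hkm : k + 1 ≤ m) {A : K} (hA : A ≠ 0) (lam : K) {c : K} (hc : c ≠ 0) :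
    Kr K Finset.univ (Hankel.w K m m (expSeq K A lam + ppSeq K m 0 c)) k =
      frameIdeal K m (uvec K m lam) k ⊓ frameIdeal K m (Hankel.Y K m) k := by
  have h := Kr_w_psecSeq K m hk (r := 1) (by omega) (by omega) (A := fun _ => A) (lam := fun _ => lam) (fun _ => hA) hc
    (Function.injective_of_subsingleton _)
  have e : psecSeq K m (fun _ : Fin 1 => A) (fun _ => lam) c = expSeq K A lam + ppSeq K m 0 c := by
    rw [psecSeq, secSeq_eq_sum, Fin.sum_univ_one]
  rw [e] at h
  rw [h]
  congr 1
  exact iInf_const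

/-! ## §4. Finite frames and the frame at infinity are in general position -/

/-- **`dim((⋂_{i<r} F_{λ_i}(k)) ∩ F_∞(k)) + (r+1)·C(m,k) = C(2m,k)`** for distinct finite slopes, `1 ≤ k`, `r + 1 ≤ k + 1`, `r + 1 ≤ m + 1 − k`:
the `r` finite frame ideals and the frame ideal at infinity are in general position. -/
theorem finrank_iInf_frameIdeal_inf_add {r k : ℕ} (hk : 1 ≤ k) (hrk : r + 1 ≤ k + 1) (hrm : r + 1 ≤ m + 1 - k) {lam : Fin r → K}
    (hlam : Function.Injective lam) :
    finrank K ↥((⨅ i, frameIdeal K m (uvec K m (lam i)) k) ⊓ frameIdeal K m (Hankel.Y K m) k) + (r + 1) * m.choose k =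
      (m + m).choose k := by
  rw [← Kr_w_psecSeq K m hk hrk hrm (A := fun _ => (1 : K)) (fun _ => one_ne_zero) (c := (1 : K)) one_ne_zero hlam]
  exact finrank_Kr_w_psecSeq_add K m hrk hrm (fun _ => one_ne_zero) one_ne_zero hlam

end Summit.Ventures.HSemireg.Wedge.HankelSecant
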